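import Summits.Ventures.YMGap.Thresholds.OneLinkLevelTwoSD
import Summits.Ventures.YMGap.Thresholds.OneLinkLevelTwoRows
import HarnessLib

/-!
# Venture YMGap — the one-link modulus beyond first order, part 24: ROWS of the variance-refined level-two modulus through
# the star door — `MassGapAt 4 N x` for every `N ≥ 3 / 4 / 6 / 10 / 20`

HONEST FRAMING: venture file of the cell `pub-ymgap` (QuantumFields programme), strong-coupling LATTICE statements for `SU(N)`
lattice Yang–Mills on `ℤ⁴` (Wilson action, tree coupling `N·x`, 't Hooft `x`); nothing about the continuum; no decay rate beyond
`∃ c > 0`.  OUTPUT (hypothesis-free, kernel-checked), from `oneLinkKRModulus_levelTwoS` (second order of the covariance hierarchy,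
second moments by Schwinger–Dyson at the Haar scale) through ds-1's star door `StarSUNLimit.star_massGapAt_of_oneLinkKRModulus`
(`4·K·|x| ≤ 9/25` on the ball `R = 6|x|`):
* `levelTwoSK_le`: numerical envelope of `K₂ˢ(N,R)` (decreasing in `N`, increasing in `R`; rational `q ≥ √(R₀²/4 + 1/N₀²)`);
* `improvedThreshold_SU_levelTwoS_three (3 ≤ N) : ImprovedThreshold 4 N (4/125)` (`0.032`; sharp Bakry–Émery `1/32`),
  `improvedThreshold_SU_levelTwoS_four (4 ≤ N) : ImprovedThreshold 4 N (9/250)` (`0.036`; refined-means column `33/1000`),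
  `improvedThreshold_SU_levelTwoS_six (6 ≤ N) : ImprovedThreshold 4 N (77/2000)` (`0.0385`; was `9/250`),
  `improvedThreshold_SU_levelTwoS_ten (10 ≤ N) : ImprovedThreshold 4 N (1/25)` (`0.040`; was `19/500 = 0.038`),
  `improvedThreshold_SU_levelTwoS_twenty (20 ≤ N) : ImprovedThreshold 4 N (81/2000)` (`0.0405`; was `39/1000`, `N ≥ 50`: `1/25`).
Against the sharp Bakry–Émery window `1/32`: `+15 %` (`N ≥ 4`), `+23 %` (`N ≥ 6`), `+28 %` (`N ≥ 10`), `+30 %` (`N ≥ 20`); against SZZ's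
printed `1/48`: `×1.73 … ×1.94`.  Supremum of this column as `N → ∞`: `0.0410`.  Sentence-grade all-`N` rows; the cell note's
`μ₂`/`ω` refinements are NOT claimed.
-/

noncomputable section

open scoped Matrix ComplexConjugate BigOperators ContDiff Matrix.Norms.Frobenius
open Matrix Complex Finset MeasureTheory ProbabilityTheory
open Literature.MathematicalPhysics.QuantumFieldTheory
open Literature.MathematicalPhysics.QuantumFieldTheory.SUNBakryEmery
open Literature.MathematicalPhysics.QuantumFieldTheory.Balaban1983to89.StrongCouplingDobrushinWindow
open Literature.MathematicalPhysics.QuantumFieldTheory.Balaban1983to89.StrongCouplingKernelWindow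

namespace Summit.Ventures.YMGap.OneLinkEigen

variable {N : ℕ}

section LevelTwoSRows

open Summit.Ventures.YMGap.StarSUNLimit (star_massGapAt_of_oneLinkKRModulus)
open Summit.Ventures.YMGap.OneLinkEigenRows (casimirFactor_le)

/-- **Numerical envelope of `K₂ˢ(N,R)`**: for `N ≥ N₀ ≥ 3`, `0 ≤ R ≤ R₀ < 1/2` and a rational `q ≥ 0` with `q² ≥ R₀²/4 + 1/N₀²`,
`K₂ˢ(N,R) ≤ K̄₂ˢ(N₀,R₀;q)` (the same expression at `N₀`, `R₀`, with `√(R₀²/4 + 1/N₀²)` replaced by `q`): `C`, `E` decrease in `N`,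
`1/N²` decreases, every term increases in `R`. [folklore] -/
theorem levelTwoSK_le {N₀ : ℕ} (hN₀ : 3 ≤ N₀) (hN : N₀ ≤ N) {R R₀ q : ℝ} (hR0 : 0 ≤ R) (hRR₀ : R ≤ R₀) (hR₀ : R₀ < 1 / 2)
    (hq : 0 ≤ q) (hq2 : R₀ ^ 2 / 4 + 1 / (N₀ : ℝ) ^ 2 ≤ q ^ 2) :
    ((N : ℝ) ^ 2 / ((N : ℝ) ^ 2 - 1)) *
        (1 + ((N : ℝ) ^ 2 / (2 * ((N : ℝ) ^ 2 - 4))) * R + 2 * (((N : ℝ) ^ 2 / (2 * ((N : ℝ) ^ 2 - 4))) + 1 / 4) * (R ^ 2 / 2 + R * Real.sqrt (R ^ 2 / 4 + 1 / (N : ℝ) ^ 2))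
          + ((5 * ((N : ℝ) ^ 2 / (2 * ((N : ℝ) ^ 2 - 4))) + 1 / 4) * R ^ 2 + (10 * ((N : ℝ) ^ 2 / (2 * ((N : ℝ) ^ 2 - 4))) + 1 / 2) * R * (R ^ 2 / 2 + R * Real.sqrt (R ^ 2 / 4 + 1 / (N : ℝ) ^ 2))) / (1 / 2 - R)) ≤
      ((N₀ : ℝ) ^ 2 / ((N₀ : ℝ) ^ 2 - 1)) *
        (1 + ((N₀ : ℝ) ^ 2 / (2 * ((N₀ : ℝ) ^ 2 - 4))) * (R₀) + 2 * (((N₀ : ℝ) ^ 2 / (2 * ((N₀ : ℝ) ^ 2 - 4))) + 1 / 4) * ((R₀) ^ 2 / 2 + (R₀) * (q))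
          + ((5 * ((N₀ : ℝ) ^ 2 / (2 * ((N₀ : ℝ) ^ 2 - 4))) + 1 / 4) * (R₀) ^ 2 + (10 * ((N₀ : ℝ) ^ 2 / (2 * ((N₀ : ℝ) ^ 2 - 4))) + 1 / 2) * (R₀) * ((R₀) ^ 2 / 2 + (R₀) * (q))) / (1 / 2 - (R₀))) := by
  have h0 : (3 : ℝ) ≤ N₀ := by exact_mod_cast hN₀
  have h1 : (N₀ : ℝ) ≤ N := by exact_mod_cast hN
  have hN4 : (0 : ℝ) < (N : ℝ) ^ 2 - 4 := by nlinarith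
  have hN1 : (0 : ℝ) < (N : ℝ) ^ 2 - 1 := by nlinarith
  have hN4' : (0 : ℝ) < (N₀ : ℝ) ^ 2 - 4 := by nlinarith
  have hN1' : (0 : ℝ) < (N₀ : ℝ) ^ 2 - 1 := by nlinarith
  have hNpos : (0 : ℝ) < N := by linarith
  have hN₀pos : (0 : ℝ) < N₀ := by linarith
  have hC := casimirFactor_le (N₀ := N₀) (N := N) (by omega) hN
  have hE := levelTwoE_le hN₀ hN
  set C : ℝ := (N : ℝ) ^ 2 / ((N : ℝ) ^ 2 - 1) with hCdef
  set E : ℝ := (N : ℝ) ^ 2 / (2 * ((N : ℝ) ^ 2 - 4)) with hEdef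
  set C₀ : ℝ := (N₀ : ℝ) ^ 2 / ((N₀ : ℝ) ^ 2 - 1) with hC₀def
  set E₀ : ℝ := (N₀ : ℝ) ^ 2 / (2 * ((N₀ : ℝ) ^ 2 - 4)) with hE₀def
  have hC0 : 0 ≤ C := div_nonneg (by positivity) hN1.le
  have hC₀0 : 0 ≤ C₀ := div_nonneg (by positivity) hN1'.le
  have hE0 : 0 ≤ E := by positivity
  have hE₀0 : 0 ≤ E₀ := by positivity
  have hR₀0 : 0 ≤ R₀ := hR0.trans hRR₀
  have hT₀ : 0 < 1 / 2 - R₀ := by linarith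
  have hT : 0 < 1 / 2 - R := by linarith
  have p2 : R ^ 2 ≤ R₀ ^ 2 := pow_le_pow_left₀ hR0 hRR₀ 2
  have hinv : 1 / (N : ℝ) ^ 2 ≤ 1 / (N₀ : ℝ) ^ 2 :=
    one_div_le_one_div_of_le (by positivity) (pow_le_pow_left₀ hN₀pos.le h1 2)
  have hs : Real.sqrt (R ^ 2 / 4 + 1 / (N : ℝ) ^ 2) ≤ q :=
    (Real.sqrt_le_sqrt (by linarith only [p2, hinv, hq2])).trans (le_of_eq (Real.sqrt_sq hq))
  have hw : R ^ 2 / 2 + R * Real.sqrt (R ^ 2 / 4 + 1 / (N : ℝ) ^ 2) ≤ R₀ ^ 2 / 2 + R₀ * q := by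
    have := mul_le_mul hRR₀ hs (Real.sqrt_nonneg _) hR₀0
    linarith only [this, p2]
  have hw0 : 0 ≤ R ^ 2 / 2 + R * Real.sqrt (R ^ 2 / 4 + 1 / (N : ℝ) ^ 2) := by positivity
  have hwq0 : 0 ≤ R₀ ^ 2 / 2 + R₀ * q := by positivity
  have t1 : E * R ≤ E₀ * R₀ := mul_le_mul hE hRR₀ hR0 hE₀0
  have t2 : 2 * (E + 1 / 4) * (R ^ 2 / 2 + R * Real.sqrt (R ^ 2 / 4 + 1 / (N : ℝ) ^ 2)) ≤ 2 * (E₀ + 1 / 4) * (R₀ ^ 2 / 2 + R₀ * q) :=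
    mul_le_mul (by linarith only [hE]) hw hw0 (by positivity)
  have n1 : (5 * E + 1 / 4) * R ^ 2 ≤ (5 * E₀ + 1 / 4) * R₀ ^ 2 := mul_le_mul (by linarith only [hE]) p2 (by positivity) (by positivity)
  have n2 : (10 * E + 1 / 2) * R * (R ^ 2 / 2 + R * Real.sqrt (R ^ 2 / 4 + 1 / (N : ℝ) ^ 2)) ≤
      (10 * E₀ + 1 / 2) * R₀ * (R₀ ^ 2 / 2 + R₀ * q) :=
    mul_le_mul (mul_le_mul (by linarith only [hE]) hRR₀ hR0 (by positivity)) hw hw0 (by positivity)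
  have hnum0 : 0 ≤ (5 * E₀ + 1 / 4) * R₀ ^ 2 + (10 * E₀ + 1 / 2) * R₀ * (R₀ ^ 2 / 2 + R₀ * q) := by positivity
  have hfrac : ((5 * E + 1 / 4) * R ^ 2 + (10 * E + 1 / 2) * R * (R ^ 2 / 2 + R * Real.sqrt (R ^ 2 / 4 + 1 / (N : ℝ) ^ 2)))
      / (1 / 2 - R) ≤
      ((5 * E₀ + 1 / 4) * R₀ ^ 2 + (10 * E₀ + 1 / 2) * R₀ * (R₀ ^ 2 / 2 + R₀ * q)) / (1 / 2 - R₀) :=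
    div_le_div₀ hnum0 (by linarith only [n1, n2]) hT₀ (by linarith only [hRR₀])
  have hbody0 : 0 ≤ 1 + E * R + 2 * (E + 1 / 4) * (R ^ 2 / 2 + R * Real.sqrt (R ^ 2 / 4 + 1 / (N : ℝ) ^ 2))
      + ((5 * E + 1 / 4) * R ^ 2 + (10 * E + 1 / 2) * R * (R ^ 2 / 2 + R * Real.sqrt (R ^ 2 / 4 + 1 / (N : ℝ) ^ 2)))
        / (1 / 2 - R) := by positivity
  exact mul_le_mul hC (by linarith only [t1, t2, hfrac]) hbody0 hC₀0

/-- **`MassGapAt 4 N x` for every `N ≥ 3` at every 't Hooft `|x| ≤ 4 / 125`** (`0.032`), hypothesis-free, by the DS route (star door)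
with the variance-refined level-two one-link modulus (bracket `R₀ = 24 / 125`, `q = 3469 / 10000`). [folklore] -/
theorem massGapAt_SU_levelTwoS_three (hN : 3 ≤ N) {x : ℝ} (h : |x| ≤ 4 / 125) : MassGapAt 4 N x := by
  have hx0 : 0 ≤ |x| := abs_nonneg x
  have hR : |x| * 6 < 1 / 2 := by linarith
  have hN3 : 3 ≤ N := by omega
  have hx6 : 0 ≤ |x| * 6 := by positivity
  have hK := levelTwoSK_le (N₀ := 3) (N := N) (by norm_num) hN (R := |x| * 6) (R₀ := 24 / 125) (q := 3469 / 10000)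
    hx6 (by linarith) (by norm_num) (by norm_num) (by norm_num)
  have hK0 : 0 ≤ ((N : ℝ) ^ 2 / ((N : ℝ) ^ 2 - 1)) *
        (1 + ((N : ℝ) ^ 2 / (2 * ((N : ℝ) ^ 2 - 4))) * (|x| * 6) + 2 * (((N : ℝ) ^ 2 / (2 * ((N : ℝ) ^ 2 - 4))) + 1 / 4) * ((|x| * 6) ^ 2 / 2 + (|x| * 6) * Real.sqrt ((|x| * 6) ^ 2 / 4 + 1 / (N : ℝ) ^ 2))
          + ((5 * ((N : ℝ) ^ 2 / (2 * ((N : ℝ) ^ 2 - 4))) + 1 / 4) * (|x| * 6) ^ 2 + (10 * ((N : ℝ) ^ 2 / (2 * ((N : ℝ) ^ 2 - 4))) + 1 / 2) * (|x| * 6) * ((|x| * 6) ^ 2 / 2 + (|x| * 6) * Real.sqrt ((|x| * 6) ^ 2 / 4 + 1 / (N : ℝ) ^ 2))) / (1 / 2 - (|x| * 6))) := by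
    have h10 : (3 : ℝ) ≤ N := by exact_mod_cast hN
    have hN4 : (0 : ℝ) < (N : ℝ) ^ 2 - 4 := by nlinarith
    have hN1 : (0 : ℝ) < (N : ℝ) ^ 2 - 1 := by nlinarith
    have : 0 ≤ (N : ℝ) ^ 2 / ((N : ℝ) ^ 2 - 1) := div_nonneg (by positivity) hN1.le
    have : 0 ≤ (N : ℝ) ^ 2 / (2 * ((N : ℝ) ^ 2 - 4)) := div_nonneg (by positivity) (by positivity)
    have : 0 < 1 / 2 - |x| * 6 := by linarith
    positivity
  refine star_massGapAt_of_oneLinkKRModulus (by omega) hK0 le_rfl (oneLinkKRModulus_levelTwoS hN3 hR) ?_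
  have hnum : ((3 : ℝ) ^ 2 / ((3 : ℝ) ^ 2 - 1)) *
        (1 + ((3 : ℝ) ^ 2 / (2 * ((3 : ℝ) ^ 2 - 4))) * (24 / 125) + 2 * (((3 : ℝ) ^ 2 / (2 * ((3 : ℝ) ^ 2 - 4))) + 1 / 4) * ((24 / 125) ^ 2 / 2 + (24 / 125) * (3469 / 10000))
          + ((5 * ((3 : ℝ) ^ 2 / (2 * ((3 : ℝ) ^ 2 - 4))) + 1 / 4) * (24 / 125) ^ 2 + (10 * ((3 : ℝ) ^ 2 / (2 * ((3 : ℝ) ^ 2 - 4))) + 1 / 2) * (24 / 125) * ((24 / 125) ^ 2 / 2 + (24 / 125) * (3469 / 10000))) / (1 / 2 - (24 / 125))) * (4 / 125) ≤ 9 / 100 := by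
    norm_num
  push_cast at hK
  nlinarith [mul_le_mul hK h (abs_nonneg x) (by norm_num), hK0]

/-- **`ImprovedThreshold 4 N (4 / 125)` for every `N ≥ 3`, hypothesis-free** (`0.032`). [folklore] -/
theorem improvedThreshold_SU_levelTwoS_three (hN : 3 ≤ N) : ImprovedThreshold 4 N (4 / 125) :=
  ⟨by norm_num, fun _ hx => massGapAt_SU_levelTwoS_three hN hx.le⟩

/-- **`MassGapAt 4 N x` for every `N ≥ 4` at every 't Hooft `|x| ≤ 9 / 250`** (`0.036`), hypothesis-free, by the DS route (star door)
with the variance-refined level-two one-link modulus (bracket `R₀ = 27 / 125`, `q = 681 / 2500`). [folklore] -/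
theorem massGapAt_SU_levelTwoS_four (hN : 4 ≤ N) {x : ℝ} (h : |x| ≤ 9 / 250) : MassGapAt 4 N x := by
  have hx0 : 0 ≤ |x| := abs_nonneg x
  have hR : |x| * 6 < 1 / 2 := by linarith
  have hN3 : 3 ≤ N := by omega
  have hx6 : 0 ≤ |x| * 6 := by positivity
  have hK := levelTwoSK_le (N₀ := 4) (N := N) (by norm_num) hN (R := |x| * 6) (R₀ := 27 / 125) (q := 681 / 2500)
    hx6 (by linarith) (by norm_num) (by norm_num) (by norm_num)
  have hK0 : 0 ≤ ((N : ℝ) ^ 2 / ((N : ℝ) ^ 2 - 1)) *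
        (1 + ((N : ℝ) ^ 2 / (2 * ((N : ℝ) ^ 2 - 4))) * (|x| * 6) + 2 * (((N : ℝ) ^ 2 / (2 * ((N : ℝ) ^ 2 - 4))) + 1 / 4) * ((|x| * 6) ^ 2 / 2 + (|x| * 6) * Real.sqrt ((|x| * 6) ^ 2 / 4 + 1 / (N : ℝ) ^ 2))
          + ((5 * ((N : ℝ) ^ 2 / (2 * ((N : ℝ) ^ 2 - 4))) + 1 / 4) * (|x| * 6) ^ 2 + (10 * ((N : ℝ) ^ 2 / (2 * ((N : ℝ) ^ 2 - 4))) + 1 / 2) * (|x| * 6) * ((|x| * 6) ^ 2 / 2 + (|x| * 6) * Real.sqrt ((|x| * 6) ^ 2 / 4 + 1 / (N : ℝ) ^ 2))) / (1 / 2 - (|x| * 6))) := by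
    have h10 : (4 : ℝ) ≤ N := by exact_mod_cast hN
    have hN4 : (0 : ℝ) < (N : ℝ) ^ 2 - 4 := by nlinarith
    have hN1 : (0 : ℝ) < (N : ℝ) ^ 2 - 1 := by nlinarith
    have : 0 ≤ (N : ℝ) ^ 2 / ((N : ℝ) ^ 2 - 1) := div_nonneg (by positivity) hN1.le
    have : 0 ≤ (N : ℝ) ^ 2 / (2 * ((N : ℝ) ^ 2 - 4)) := div_nonneg (by positivity) (by positivity)
    have : 0 < 1 / 2 - |x| * 6 := by linarith
    positivity
  refine star_massGapAt_of_oneLinkKRModulus (by omega) hK0 le_rfl (oneLinkKRModulus_levelTwoS hN3 hR) ?_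
  have hnum : ((4 : ℝ) ^ 2 / ((4 : ℝ) ^ 2 - 1)) *
        (1 + ((4 : ℝ) ^ 2 / (2 * ((4 : ℝ) ^ 2 - 4))) * (27 / 125) + 2 * (((4 : ℝ) ^ 2 / (2 * ((4 : ℝ) ^ 2 - 4))) + 1 / 4) * ((27 / 125) ^ 2 / 2 + (27 / 125) * (681 / 2500))
          + ((5 * ((4 : ℝ) ^ 2 / (2 * ((4 : ℝ) ^ 2 - 4))) + 1 / 4) * (27 / 125) ^ 2 + (10 * ((4 : ℝ) ^ 2 / (2 * ((4 : ℝ) ^ 2 - 4))) + 1 / 2) * (27 / 125) * ((27 / 125) ^ 2 / 2 + (27 / 125) * (681 / 2500))) / (1 / 2 - (27 / 125))) * (9 / 250) ≤ 9 / 100 := by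
    norm_num
  push_cast at hK
  nlinarith [mul_le_mul hK h (abs_nonneg x) (by norm_num), hK0]

/-- **`ImprovedThreshold 4 N (9 / 250)` for every `N ≥ 4`, hypothesis-free** (`0.036`). [folklore] -/
theorem improvedThreshold_SU_levelTwoS_four (hN : 4 ≤ N) : ImprovedThreshold 4 N (9 / 250) :=
  ⟨by norm_num, fun _ hx => massGapAt_SU_levelTwoS_four hN hx.le⟩

/-- **`MassGapAt 4 N x` for every `N ≥ 6` at every 't Hooft `|x| ≤ 77 / 2000`** (`0.0385`), hypothesis-free, by the DS route (star door)
with the variance-refined level-two one-link modulus (bracket `R₀ = 231 / 1000`, `q = 507 / 2500`). [folklore] -/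
theorem massGapAt_SU_levelTwoS_six (hN : 6 ≤ N) {x : ℝ} (h : |x| ≤ 77 / 2000) : MassGapAt 4 N x := by
  have hx0 : 0 ≤ |x| := abs_nonneg x
  have hR : |x| * 6 < 1 / 2 := by linarith
  have hN3 : 3 ≤ N := by omega
  have hx6 : 0 ≤ |x| * 6 := by positivity
  have hK := levelTwoSK_le (N₀ := 6) (N := N) (by norm_num) hN (R := |x| * 6) (R₀ := 231 / 1000) (q := 507 / 2500)
    hx6 (by linarith) (by norm_num) (by norm_num) (by norm_num)
  have hK0 : 0 ≤ ((N : ℝ) ^ 2 / ((N : ℝ) ^ 2 - 1)) *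
        (1 + ((N : ℝ) ^ 2 / (2 * ((N : ℝ) ^ 2 - 4))) * (|x| * 6) + 2 * (((N : ℝ) ^ 2 / (2 * ((N : ℝ) ^ 2 - 4))) + 1 / 4) * ((|x| * 6) ^ 2 / 2 + (|x| * 6) * Real.sqrt ((|x| * 6) ^ 2 / 4 + 1 / (N : ℝ) ^ 2))
          + ((5 * ((N : ℝ) ^ 2 / (2 * ((N : ℝ) ^ 2 - 4))) + 1 / 4) * (|x| * 6) ^ 2 + (10 * ((N : ℝ) ^ 2 / (2 * ((N : ℝ) ^ 2 - 4))) + 1 / 2) * (|x| * 6) * ((|x| * 6) ^ 2 / 2 + (|x| * 6) * Real.sqrt ((|x| * 6) ^ 2 / 4 + 1 / (N : ℝ) ^ 2))) / (1 / 2 - (|x| * 6))) := by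
    have h10 : (6 : ℝ) ≤ N := by exact_mod_cast hN
    have hN4 : (0 : ℝ) < (N : ℝ) ^ 2 - 4 := by nlinarith
    have hN1 : (0 : ℝ) < (N : ℝ) ^ 2 - 1 := by nlinarith
    have : 0 ≤ (N : ℝ) ^ 2 / ((N : ℝ) ^ 2 - 1) := div_nonneg (by positivity) hN1.le
    have : 0 ≤ (N : ℝ) ^ 2 / (2 * ((N : ℝ) ^ 2 - 4)) := div_nonneg (by positivity) (by positivity)
    have : 0 < 1 / 2 - |x| * 6 := by linarith
    positivity
  refine star_massGapAt_of_oneLinkKRModulus (by omega) hK0 le_rfl (oneLinkKRModulus_levelTwoS hN3 hR) ?_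
  have hnum : ((6 : ℝ) ^ 2 / ((6 : ℝ) ^ 2 - 1)) *
        (1 + ((6 : ℝ) ^ 2 / (2 * ((6 : ℝ) ^ 2 - 4))) * (231 / 1000) + 2 * (((6 : ℝ) ^ 2 / (2 * ((6 : ℝ) ^ 2 - 4))) + 1 / 4) * ((231 / 1000) ^ 2 / 2 + (231 / 1000) * (507 / 2500))
          + ((5 * ((6 : ℝ) ^ 2 / (2 * ((6 : ℝ) ^ 2 - 4))) + 1 / 4) * (231 / 1000) ^ 2 + (10 * ((6 : ℝ) ^ 2 / (2 * ((6 : ℝ) ^ 2 - 4))) + 1 / 2) * (231 / 1000) * ((231 / 1000) ^ 2 / 2 + (231 / 1000) * (507 / 2500))) / (1 / 2 - (231 / 1000))) * (77 / 2000) ≤ 9 / 100 := by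
    norm_num
  push_cast at hK
  nlinarith [mul_le_mul hK h (abs_nonneg x) (by norm_num), hK0]

/-- **`ImprovedThreshold 4 N (77 / 2000)` for every `N ≥ 6`, hypothesis-free** (`0.0385`). [folklore] -/
theorem improvedThreshold_SU_levelTwoS_six (hN : 6 ≤ N) : ImprovedThreshold 4 N (77 / 2000) :=
  ⟨by norm_num, fun _ hx => massGapAt_SU_levelTwoS_six hN hx.le⟩

/-- **`MassGapAt 4 N x` for every `N ≥ 10` at every 't Hooft `|x| ≤ 1 / 25`** (`0.040`), hypothesis-free, by the DS route (star door)
with the variance-refined level-two one-link modulus (bracket `R₀ = 6 / 25`, `q = 1563 / 10000`). [folklore] -/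
theorem massGapAt_SU_levelTwoS_ten (hN : 10 ≤ N) {x : ℝ} (h : |x| ≤ 1 / 25) : MassGapAt 4 N x := by
  have hx0 : 0 ≤ |x| := abs_nonneg x
  have hR : |x| * 6 < 1 / 2 := by linarith
  have hN3 : 3 ≤ N := by omega
  have hx6 : 0 ≤ |x| * 6 := by positivity
  have hK := levelTwoSK_le (N₀ := 10) (N := N) (by norm_num) hN (R := |x| * 6) (R₀ := 6 / 25) (q := 1563 / 10000)
    hx6 (by linarith) (by norm_num) (by norm_num) (by norm_num)
  have hK0 : 0 ≤ ((N : ℝ) ^ 2 / ((N : ℝ) ^ 2 - 1)) *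
        (1 + ((N : ℝ) ^ 2 / (2 * ((N : ℝ) ^ 2 - 4))) * (|x| * 6) + 2 * (((N : ℝ) ^ 2 / (2 * ((N : ℝ) ^ 2 - 4))) + 1 / 4) * ((|x| * 6) ^ 2 / 2 + (|x| * 6) * Real.sqrt ((|x| * 6) ^ 2 / 4 + 1 / (N : ℝ) ^ 2))
          + ((5 * ((N : ℝ) ^ 2 / (2 * ((N : ℝ) ^ 2 - 4))) + 1 / 4) * (|x| * 6) ^ 2 + (10 * ((N : ℝ) ^ 2 / (2 * ((N : ℝ) ^ 2 - 4))) + 1 / 2) * (|x| * 6) * ((|x| * 6) ^ 2 / 2 + (|x| * 6) * Real.sqrt ((|x| * 6) ^ 2 / 4 + 1 / (N : ℝ) ^ 2))) / (1 / 2 - (|x| * 6))) := by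
    have h10 : (10 : ℝ) ≤ N := by exact_mod_cast hN
    have hN4 : (0 : ℝ) < (N : ℝ) ^ 2 - 4 := by nlinarith
    have hN1 : (0 : ℝ) < (N : ℝ) ^ 2 - 1 := by nlinarith
    have : 0 ≤ (N : ℝ) ^ 2 / ((N : ℝ) ^ 2 - 1) := div_nonneg (by positivity) hN1.le
    have : 0 ≤ (N : ℝ) ^ 2 / (2 * ((N : ℝ) ^ 2 - 4)) := div_nonneg (by positivity) (by positivity)
    have : 0 < 1 / 2 - |x| * 6 := by linarith
    positivity
  refine star_massGapAt_of_oneLinkKRModulus (by omega) hK0 le_rfl (oneLinkKRModulus_levelTwoS hN3 hR) ?_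
  have hnum : ((10 : ℝ) ^ 2 / ((10 : ℝ) ^ 2 - 1)) *
        (1 + ((10 : ℝ) ^ 2 / (2 * ((10 : ℝ) ^ 2 - 4))) * (6 / 25) + 2 * (((10 : ℝ) ^ 2 / (2 * ((10 : ℝ) ^ 2 - 4))) + 1 / 4) * ((6 / 25) ^ 2 / 2 + (6 / 25) * (1563 / 10000))
          + ((5 * ((10 : ℝ) ^ 2 / (2 * ((10 : ℝ) ^ 2 - 4))) + 1 / 4) * (6 / 25) ^ 2 + (10 * ((10 : ℝ) ^ 2 / (2 * ((10 : ℝ) ^ 2 - 4))) + 1 / 2) * (6 / 25) * ((6 / 25) ^ 2 / 2 + (6 / 25) * (1563 / 10000))) / (1 / 2 - (6 / 25))) * (1 / 25) ≤ 9 / 100 := by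
    norm_num
  push_cast at hK
  nlinarith [mul_le_mul hK h (abs_nonneg x) (by norm_num), hK0]

/-- **`ImprovedThreshold 4 N (1 / 25)` for every `N ≥ 10`, hypothesis-free** (`0.040`). [folklore] -/
theorem improvedThreshold_SU_levelTwoS_ten (hN : 10 ≤ N) : ImprovedThreshold 4 N (1 / 25) :=
  ⟨by norm_num, fun _ hx => massGapAt_SU_levelTwoS_ten hN hx.le⟩

/-- **`MassGapAt 4 N x` for every `N ≥ 20` at every 't Hooft `|x| ≤ 81 / 2000`** (`0.0405`), hypothesis-free, by the DS route (star door)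
with the variance-refined level-two one-link modulus (bracket `R₀ = 243 / 1000`, `q = 657 / 5000`). [folklore] -/
theorem massGapAt_SU_levelTwoS_twenty (hN : 20 ≤ N) {x : ℝ} (h : |x| ≤ 81 / 2000) : MassGapAt 4 N x := by
  have hx0 : 0 ≤ |x| := abs_nonneg x
  have hR : |x| * 6 < 1 / 2 := by linarith
  have hN3 : 3 ≤ N := by omega
  have hx6 : 0 ≤ |x| * 6 := by positivity
  have hK := levelTwoSK_le (N₀ := 20) (N := N) (by norm_num) hN (R := |x| * 6) (R₀ := 243 / 1000) (q := 657 / 5000)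
    hx6 (by linarith) (by norm_num) (by norm_num) (by norm_num)
  have hK0 : 0 ≤ ((N : ℝ) ^ 2 / ((N : ℝ) ^ 2 - 1)) *
        (1 + ((N : ℝ) ^ 2 / (2 * ((N : ℝ) ^ 2 - 4))) * (|x| * 6) + 2 * (((N : ℝ) ^ 2 / (2 * ((N : ℝ) ^ 2 - 4))) + 1 / 4) * ((|x| * 6) ^ 2 / 2 + (|x| * 6) * Real.sqrt ((|x| * 6) ^ 2 / 4 + 1 / (N : ℝ) ^ 2))
          + ((5 * ((N : ℝ) ^ 2 / (2 * ((N : ℝ) ^ 2 - 4))) + 1 / 4) * (|x| * 6) ^ 2 + (10 * ((N : ℝ) ^ 2 / (2 * ((N : ℝ) ^ 2 - 4))) + 1 / 2) * (|x| * 6) * ((|x| * 6) ^ 2 / 2 + (|x| * 6) * Real.sqrt ((|x| * 6) ^ 2 / 4 + 1 / (N : ℝ) ^ 2))) / (1 / 2 - (|x| * 6))) := by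
    have h10 : (20 : ℝ) ≤ N := by exact_mod_cast hN
    have hN4 : (0 : ℝ) < (N : ℝ) ^ 2 - 4 := by nlinarith
    have hN1 : (0 : ℝ) < (N : ℝ) ^ 2 - 1 := by nlinarith
    have : 0 ≤ (N : ℝ) ^ 2 / ((N : ℝ) ^ 2 - 1) := div_nonneg (by positivity) hN1.le
    have : 0 ≤ (N : ℝ) ^ 2 / (2 * ((N : ℝ) ^ 2 - 4)) := div_nonneg (by positivity) (by positivity)
    have : 0 < 1 / 2 - |x| * 6 := by linarith
    positivity
  refine star_massGapAt_of_oneLinkKRModulus (by omega) hK0 le_rfl (oneLinkKRModulus_levelTwoS hN3 hR) ?_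
  have hnum : ((20 : ℝ) ^ 2 / ((20 : ℝ) ^ 2 - 1)) *
        (1 + ((20 : ℝ) ^ 2 / (2 * ((20 : ℝ) ^ 2 - 4))) * (243 / 1000) + 2 * (((20 : ℝ) ^ 2 / (2 * ((20 : ℝ) ^ 2 - 4))) + 1 / 4) * ((243 / 1000) ^ 2 / 2 + (243 / 1000) * (657 / 5000))
          + ((5 * ((20 : ℝ) ^ 2 / (2 * ((20 : ℝ) ^ 2 - 4))) + 1 / 4) * (243 / 1000) ^ 2 + (10 * ((20 : ℝ) ^ 2 / (2 * ((20 : ℝ) ^ 2 - 4))) + 1 / 2) * (243 / 1000) * ((243 / 1000) ^ 2 / 2 + (243 / 1000) * (657 / 5000))) / (1 / 2 - (243 / 1000))) * (81 / 2000) ≤ 9 / 100 := by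
    norm_num
  push_cast at hK
  nlinarith [mul_le_mul hK h (abs_nonneg x) (by norm_num), hK0]

/-- **`ImprovedThreshold 4 N (81 / 2000)` for every `N ≥ 20`, hypothesis-free** (`0.0405`). [folklore] -/
theorem improvedThreshold_SU_levelTwoS_twenty (hN : 20 ≤ N) : ImprovedThreshold 4 N (81 / 2000) :=
  ⟨by norm_num, fun _ hx => massGapAt_SU_levelTwoS_twenty hN hx.le⟩

/-- The variance-refined numbers: `1/32 < 4/125 < 9/250 < 77/2000 < 1/25 < 81/2000` and the refined-means rows they supersede
(`33/1000 < 9/250`, `9/250 < 77/2000`, `19/500 < 1/25`, `39/1000 < 81/2000`, `1/25 < 81/2000`). [folklore] -/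
theorem threshold_numbers_levelTwoS :
    (1 : ℝ) / 32 < 4 / 125 ∧ (4 : ℝ) / 125 < 9 / 250 ∧ (9 : ℝ) / 250 < 77 / 2000 ∧ (77 : ℝ) / 2000 < 1 / 25 ∧
      (1 : ℝ) / 25 < 81 / 2000 ∧ (33 : ℝ) / 1000 < 9 / 250 ∧ (19 : ℝ) / 500 < 1 / 25 ∧ (39 : ℝ) / 1000 < 81 / 2000 := by
  norm_num

end LevelTwoSRows

end Summit.Ventures.YMGap.OneLinkEigen
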